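import Summits.RiemannHypothesis.RiemannHypothesis.Theorems.Splittings.JensenWindowDeGuaCount
import Summits.RiemannHypothesis.RiemannHypothesis.Theses.EarlyAppointments
import HarnessLib

/-!
# EarlyAppointments · LocalFourierPolya (stmt-RiemannHypothesis-3185) — part 4/4, the item proof (zero definitions)

Cell rh-split, seat rh-split-jen-neg g7 (scratch `SketchG7.lean` 02ca2ea96404222a; staged monolith 1f49da2f12defbf0, farm
rc 0 / 0 sorries, standard axioms; referee g5 REPLAY PASS ×2 + BYTES PASS), cut per rh-split-lead RULING #63/#63b (OPTION A:
all four parts under Theorems/Splittings/, parts 1–3 def-carrying = definition lane, part 4 = the item proof).  Decl bodies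
verbatim (renames vs the monolith: `zeroCount ↦ zeroCountC`, `exists_ball_ne_zero ↦ exists_ball_ne_zero_of_entire`; the helper
`analyticOrderAt_ne_top_of_entire` became private copies `…_aux`).  Zero `sorry`, no instances, no notation.
HONEST LABEL: «SPLITTING SEARCH over kernel-typed RH-EQUIVALENCES; a splitting A ∧ B ⟹ RH is CONDITIONAL
bookkeeping unless A and B are both proved; nothing here bears on the truth of RH.»

IN PRINT: the census identity, the real-axis Rolle/Pólya equation and the local critical-point count
are Y.-O. Kim, Proc. AMS 124 (1996) 819–830 [Kim1996], Theorem 1 p. 821 and its proof — (2.3) `Im z · Im f'/f < 0` off the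
Jensen set, (2.4) `(1/2π) Δ_Γ arg f'/f = ½(sgn f'(a)/f(a) − sgn f'(b)/f(b))`, and Pólya's 1930 equation
`2K = N' − N − ½(sgn f'(a)/f(a) − sgn f'(b)/f(b))` (Quart. J. Math. Oxford 1, pp. 29–30), pp. 822–823 — stated there for `f` of
genus `1*` on a strip `a ≤ Re z ≤ b` with `a, b` outside the Jensen set.  Here: an ARBITRARY real entire `f`, a bounded window
`[α,β] × [−h,h]`, the pointwise boundary-sign hypothesis `Im w · Im (f'/f)(w) < 0` on the non-real boundary (which (2.3)
supplies in Kim's setting), multiplicities, and the exact rectangle argument principle of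
`Literature.Analysis.Complex.ArgumentPrincipleRectangle` — a formalisation and mild generalisation, not a new theorem.

`exists_nonLaguerre_critical_of_boundary_sign` (the local dichotomy of part 3 in boundary-sign form), the ε-shift lemmas
`exists_ball_ne_zero_of_entire` (isolation) and `logDeriv_im_le_near_real_zero` (near a real zero `a` of order `n ≥ 1`,
`g'/g = n/(z−a) + φ` with `φ` analytic and real on `ℝ`, so `Im (g'/g)(x+iy) ≤ −y/((x−a)²+y²) + C·y`), and
`theorem localFourierPolya : Theses.EarlyAppointments.LocalFourierPolya` — type literally the route decl (support item, rank 4;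
its docstring's remark «no local version with boundary terms is in print» is inaccurate — see IN PRINT above: Kim 1996 Thm 1):
the item's window has its vertical sides THROUGH the real zeros `α, β` (poles of `g'/g`); they are moved to `α+ε, β−ε`,
where `g·g' ≠ 0` and the boundary sign is inherited (near the axis from the pole term, above a height `y₀` by compactness),
the dichotomy yields a non-Laguerre critical point, read off on the real trace (`KiKim.hasDerivAt_re_ofReal`).
-/

noncomputable section

open Complex Filter Metric Set Topology
open scoped ComplexConjugate

set_option linter.dupNamespace false

namespace Summit.RiemannHypothesis.RiemannHypothesis.Theorems.Splittings.EarlyAppointmentsLocalFourierPolya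

open Literature.Analysis.Complex Summit.RiemannHypothesis.RiemannHypothesis.Theorems.Splittings.JensenWindow

variable {f g : ℂ → ℂ}

/-- **LOCAL FOURIER–PÓLYA (boundary-sign form; cf. the tree item
`EarlyAppointments.LocalFourierPolya`).** Let `f` be entire and real on `ℝ`, `α < β`, `0 < h`, with
`f, f' ≠ 0` at `α, β`; suppose the logarithmic field points DOWN on the upper half of `∂K`,
`K = [α,β] × [−h,h]` (top edge and upper vertical half-sides; the lower half follows by reflection),
every zero of `f'` in `K°` is real, and `f` has a non-real zero in `K°`. Then some real critical point
`x ∈ (α,β)` of `f` off its zeros violates the Laguerre sign law: `f(x) f''(x) ≥ 0`. -/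
theorem exists_nonLaguerre_critical_of_boundary_sign (hfd : Differentiable ℂ f)
    (hreal : ∀ x : ℝ, (f x).im = 0) {α β h : ℝ} (hlt : α < β) (hpos : 0 < h)
    (hfα : f α ≠ 0) (hfβ : f β ≠ 0) (hdα : deriv f α ≠ 0) (hdβ : deriv f β ≠ 0)
    (htop : ∀ x ∈ Icc α β, (deriv f ((x : ℂ) + (h : ℂ) * I) / f ((x : ℂ) + (h : ℂ) * I)).im < 0)
    (hleft : ∀ y ∈ Ioc (0 : ℝ) h, (deriv f ((α : ℂ) + (y : ℂ) * I) / f ((α : ℂ) + (y : ℂ) * I)).im < 0)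
    (hright : ∀ y ∈ Ioc (0 : ℝ) h, (deriv f ((β : ℂ) + (y : ℂ) * I) / f ((β : ℂ) + (y : ℂ) * I)).im < 0)
    (hA : LocalA f α β h) (hz : ∃ ρ ∈ Ioo α β ×ℂ Ioo (-h) h, f ρ = 0 ∧ ρ.im ≠ 0) :
    ∃ x : ℝ, x ∈ Ioo α β ∧ deriv f x = 0 ∧ f x ≠ 0 ∧ 0 ≤ (f x * deriv (deriv f) x).re := by
  -- the sign predicate
  set P : ℂ → Prop := fun w ↦ w.im * (deriv f w / f w).im < 0 with hP
  -- reflection: the field at `conj w`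
  have refl : ∀ w : ℂ, (deriv f (conj w) / f (conj w)).im = -(deriv f w / f w).im := by
    intro w; rw [logDeriv_apply_conj hfd hreal w, Complex.conj_im]
  have vert : ∀ {a : ℝ}, (∀ y ∈ Ioc (0 : ℝ) h, (deriv f ((a : ℂ) + (y : ℂ) * I) / f ((a : ℂ) + (y : ℂ) * I)).im < 0) →
      ∀ y ∈ Icc (-h) h, y ≠ 0 → P ((a : ℂ) + (y : ℂ) * I) := by
    intro a ha y hy hy0
    simp only [hP]
    have imS : ((a : ℂ) + (y : ℂ) * I).im = y := by simp
    rw [imS]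
    rcases lt_or_gt_of_ne hy0 with hneg | hposy
    · have e : ((a : ℂ) + (y : ℂ) * I) = conj ((a : ℂ) + ((-y : ℝ) : ℂ) * I) := by
        apply Complex.ext <;> simp
      have h1 := ha (-y) ⟨by linarith, by linarith [hy.1]⟩
      rw [e, refl]
      nlinarith
    · have h1 := ha y ⟨hposy, hy.2⟩
      nlinarith
  have hW : SWindow f P α β h :=
    { lt := hlt
      pos := hpos
      top := by
        intro x hx
        simp only [hP]
        have imT : ((x : ℂ) + (h : ℂ) * I).im = h := by simp
        rw [imT]
        have h1 := htop x hx
        nlinarith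
      bot := by
        intro x hx
        simp only [hP]
        have imB : ((x : ℂ) + ((-h : ℝ) : ℂ) * I).im = -h := by simp
        have e : ((x : ℂ) + ((-h : ℝ) : ℂ) * I) = conj ((x : ℂ) + (h : ℂ) * I) := by
          apply Complex.ext <;> simp
        rw [imB, e, refl]
        have h1 := htop x hx
        nlinarith
      left := vert hleft
      right := vert hright
      fα := hfα
      fβ := hfβ
      dα := hdα
      dβ := hdβ }
  by_contra hcon
  push Not at hcon
  have hB : LocalB f α β := fun x hx hd hf0 ↦ hcon x hx hd hf0
  obtain ⟨ρ, hρK, hρ0, hρim⟩ := hz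
  exact hρim (no_nonreal_zero_of_localA_localB_core hfd hreal (fun hw hc ↦ hc) hW hA hB ρ hρK hρ0)

/-! ## 3c. The tree item `EarlyAppointments.LocalFourierPolya` (endpoints at real zeros)

The route item takes the window between two REAL ZEROS `α < β` of `g` and assumes the sign of the
logarithmic field on the upper boundary.  We shift the vertical sides inward by a small `ε`:
near a real zero `a` of order `n`, `g'/g = n/(z−a) + φ` with `φ` analytic and real on the axis,
so `Im (g'/g)(a ± ε + iy) ≤ −y/(ε²+y²) + C y < 0` for small `ε, y` (Lemma A); higher up the
sign persists by compactness (Lemma B); zeros of `g, g'` near `a` are isolated. -/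

/-- An entire function which is not identically zero has finite analytic order everywhere (private copy of
`Literature.NumberTheory.LFunctions.analyticOrderAt_ne_top_of_entire`, to keep the import cone small). -/
private theorem analyticOrderAt_ne_top_of_entire_aux {g : ℂ → ℂ} (hg : Differentiable ℂ g) {a : ℂ}
    (ha : g a ≠ 0) (z : ℂ) : analyticOrderAt g z ≠ ⊤ := by
  intro htop
  rw [analyticOrderAt_eq_top] at htop
  have hAn : AnalyticOnNhd ℂ g univ := fun w _ ↦ hg.analyticAt w
  have h := hAn.eqOn_zero_of_preconnected_of_eventuallyEq_zero isPreconnected_univ (mem_univ z) htop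
  exact ha (h (mem_univ a))

/-- Isolation of zeros of a non-trivial entire function, in metric form. -/
theorem exists_ball_ne_zero_of_entire (hg : Differentiable ℂ g) (hne : ∃ z, g z ≠ 0) (a : ℂ) :
    ∃ r > 0, ∀ z : ℂ, z ≠ a → dist z a < r → g z ≠ 0 := by
  obtain ⟨z₀, hz₀⟩ := hne
  rcases (hg.analyticAt a).eventually_eq_zero_or_eventually_ne_zero with h | h
  · exact absurd (analyticOrderAt_eq_top.mpr h) (analyticOrderAt_ne_top_of_entire_aux hg hz₀ a)
  · rw [eventually_nhdsWithin_iff, Metric.eventually_nhds_iff] at h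
    obtain ⟨r, hr, hball⟩ := h
    exact ⟨r, hr, fun z hz hd ↦ hball hd hz⟩

/-- **Lemma A.** Near a real zero `a` of a real entire `g ≢ 0`, in the upper half-plane
`Im (g'/g)(x+iy) ≤ -y/((x-a)²+y²) + C·y`. -/
theorem logDeriv_im_le_near_real_zero (hg : Differentiable ℂ g)
    (hreal : ∀ x : ℝ, (g x).im = 0) (hne : ∃ z, g z ≠ 0) {a : ℝ} (ha : g a = 0) :
    ∃ r > 0, ∃ C : ℝ, ∀ x y : ℝ, |x - a| < r → x ≠ a → 0 < y → y < r →
      (deriv g ((x : ℂ) + (y : ℂ) * I) / g ((x : ℂ) + (y : ℂ) * I)).im ≤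
        -y / ((x - a) ^ 2 + y ^ 2) + C * y := by
  obtain ⟨za, hza⟩ := hne
  have hfin : analyticOrderAt g (a : ℂ) ≠ ⊤ := analyticOrderAt_ne_top_of_entire_aux hg hza _
  obtain ⟨n, hn⟩ := ENat.ne_top_iff_exists.mp hfin
  have hcast : analyticOrderAt g (a : ℂ) = n := hn.symm
  have hn1 : 1 ≤ n := by
    by_contra h0
    have h0' : n = 0 := by omega
    rw [h0', Nat.cast_zero, (hg.analyticAt _).analyticOrderAt_eq_zero] at hcast
    exact hcast ha
  obtain ⟨u, hu, hu0, hev⟩ := ((hg.analyticAt (a : ℂ)).analyticOrderAt_eq_natCast).mp hcast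
  have hev3 : ∀ᶠ z in 𝓝 (a : ℂ), g z = (z - a) ^ n * u z ∧ AnalyticAt ℂ u z ∧ u z ≠ 0 := by
    filter_upwards [hev, hu.eventually_analyticAt, hu.continuousAt.eventually_ne hu0] with z h1 h2 h3
    exact ⟨by simpa [smul_eq_mul] using h1, h2, h3⟩
  obtain ⟨r₁, hr₁, hball⟩ := Metric.eventually_nhds_iff_ball.mp hev3
  set φ : ℂ → ℂ := fun z ↦ deriv u z / u z with hφ
  have hφan : ∀ z ∈ ball (a : ℂ) r₁, AnalyticAt ℂ φ z := fun z hz ↦ by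
    obtain ⟨-, h2, h3⟩ := hball z hz
    exact h2.deriv.div h2 h3
  have hφd : ∀ z ∈ ball (a : ℂ) r₁, DifferentiableAt ℂ φ z := fun z hz ↦ (hφan z hz).differentiableAt
  have hsub : closedBall (a : ℂ) (r₁ / 2) ⊆ ball (a : ℂ) r₁ := closedBall_subset_ball (by linarith)
  have hcont : ContinuousOn (deriv φ) (closedBall (a : ℂ) (r₁ / 2)) := fun z hz ↦
    ((hφan z (hsub hz)).deriv.continuousAt).continuousWithinAt
  obtain ⟨C, hC⟩ := (isCompact_closedBall (a : ℂ) (r₁ / 2)).exists_bound_of_continuousOn hcont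
  -- the decomposition ψ = n/(w-a) + φ on the punctured ball
  have decomp : ∀ w ∈ ball (a : ℂ) r₁, w ≠ a → deriv g w / g w = n / (w - a) + φ w := by
    intro w hw hwa
    obtain ⟨h1, h2, h3⟩ := hball w hw
    have hev_w : g =ᶠ[𝓝 w] fun v ↦ (v - a) ^ n * u v := by
      filter_upwards [isOpen_ball.mem_nhds hw] with v hv using (hball v hv).1
    have hp : HasDerivAt (fun v : ℂ ↦ (v - a) ^ n) ((n : ℂ) * (w - a) ^ (n - 1) * 1) w :=
      ((hasDerivAt_id w).sub_const (a : ℂ)).pow n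
    have hd : deriv g w = (n : ℂ) * (w - a) ^ (n - 1) * u w + (w - a) ^ n * deriv u w := by
      rw [hev_w.deriv_eq]
      have hpu := (hp.mul h2.differentiableAt.hasDerivAt).deriv
      have e : (fun v : ℂ ↦ (v - a) ^ n * u v) = (fun v : ℂ ↦ (v - (a : ℂ)) ^ n) * u := rfl
      rw [e, hpu]; ring
    rw [hd, h1, hφ]
    have hwa' : w - a ≠ 0 := sub_ne_zero.mpr hwa
    obtain ⟨k, rfl⟩ : ∃ k, n = k + 1 := Nat.exists_eq_succ_of_ne_zero (by omega)
    simp only [Nat.add_sub_cancel]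
    field_simp
    ring
  refine ⟨r₁ / 4, by linarith, |C|, fun x y hx hxa hy hyr ↦ ?_⟩
  set z : ℂ := (x : ℂ) + (y : ℂ) * I with hz
  have hxmem : (x : ℂ) ∈ closedBall (a : ℂ) (r₁ / 2) := by
    rw [mem_closedBall, dist_eq_norm, ← Complex.ofReal_sub, Complex.norm_real, Real.norm_eq_abs]
    linarith
  have eza : z - a = ((x - a : ℝ) : ℂ) + (y : ℂ) * I := by simp only [hz]; push_cast; ring
  have hzmem : z ∈ closedBall (a : ℂ) (r₁ / 2) := by
    rw [mem_closedBall, dist_eq_norm, eza]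
    calc ‖((x - a : ℝ) : ℂ) + (y : ℂ) * I‖ ≤ ‖((x - a : ℝ) : ℂ)‖ + ‖(y : ℂ) * I‖ := norm_add_le _ _
      _ = |x - a| + |y| := by
        rw [Complex.norm_real, Real.norm_eq_abs, norm_mul, Complex.norm_I, mul_one, Complex.norm_real,
          Real.norm_eq_abs]
      _ ≤ r₁ / 2 := by rw [abs_of_pos hy]; linarith
  have lip : ‖φ z - φ x‖ ≤ |C| * ‖z - (x : ℂ)‖ :=
    (convex_closedBall (a : ℂ) (r₁ / 2)).norm_image_sub_le_of_norm_deriv_le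
      (fun w hw ↦ hφd w (hsub hw)) (fun w hw ↦ (hC w hw).trans (le_abs_self C)) hxmem hzmem
  have hzx : ‖z - (x : ℂ)‖ = y := by simp [hz, abs_of_pos hy]
  have hzball : z ∈ ball (a : ℂ) r₁ := hsub hzmem
  have hxball : (x : ℂ) ∈ ball (a : ℂ) r₁ := hsub hxmem
  have hza' : z ≠ a := by
    intro h
    have := congrArg Complex.im h
    simp [hz] at this
    exact hy.ne' this
  have hxa' : (x : ℂ) ≠ a := by exact_mod_cast hxa
  have him_x : (φ x).im = 0 := by
    have h1 := decomp x hxball hxa'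
    have h2 : (deriv g x / g x).im = 0 := by
      rw [Complex.div_im, hreal x, im_deriv_ofReal hg hreal x]; ring
    have h3 : ((n : ℂ) / ((x : ℂ) - a)).im = 0 := by
      rw [← Complex.ofReal_natCast, ← Complex.ofReal_sub, ← Complex.ofReal_div, Complex.ofReal_im]
    rw [h1, Complex.add_im, h3, zero_add] at h2
    exact h2
  have him_φz : (φ z).im ≤ |C| * y := by
    have h1 : (φ z).im = (φ z - φ x).im := by rw [Complex.sub_im, him_x, sub_zero]
    rw [h1, ← hzx]
    exact (Complex.im_le_norm _).trans lip  -- hmm? im ≤ |im| ≤ norm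
  have him_main : ((n : ℂ) / (z - a)).im = -(n : ℝ) * y / ((x - a) ^ 2 + y ^ 2) := by
    rw [eza]
    have hd : ((x - a) ^ 2 + y ^ 2 : ℝ) ≠ 0 := by positivity
    rw [Complex.div_im]
    simp [Complex.normSq_apply]
    try field_simp
    try ring
  rw [decomp z hzball hza', Complex.add_im, him_main]
  have hd : 0 < (x - a) ^ 2 + y ^ 2 := by positivity
  have h1 : -(n : ℝ) * y / ((x - a) ^ 2 + y ^ 2) ≤ -y / ((x - a) ^ 2 + y ^ 2) := by
    apply div_le_div_of_nonneg_right _ hd.le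
    have : (1 : ℝ) ≤ n := by exact_mod_cast hn1
    nlinarith
  linarith [him_φz]

/-- A positive number below finitely many positive bounds (bookkeeping). -/
private theorem exists_pos_lt_ten {t₁ t₂ t₃ t₄ t₅ t₆ t₇ t₈ t₉ t₀ : ℝ} (h₁ : 0 < t₁) (h₂ : 0 < t₂)
    (h₃ : 0 < t₃) (h₄ : 0 < t₄) (h₅ : 0 < t₅) (h₆ : 0 < t₆) (h₇ : 0 < t₇) (h₈ : 0 < t₈)
    (h₉ : 0 < t₉) (h₀ : 0 < t₀) :
    ∃ ε : ℝ, 0 < ε ∧ ε < t₁ ∧ ε < t₂ ∧ ε < t₃ ∧ ε < t₄ ∧ ε < t₅ ∧ ε < t₆ ∧ ε < t₇ ∧ ε < t₈ ∧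
      ε < t₉ ∧ ε < t₀ := by
  set m := min (min (min t₁ t₂) (min t₃ t₄)) (min (min (min t₅ t₆) (min t₇ t₈)) (min t₉ t₀)) with hm
  have hmpos : 0 < m := by simp only [hm, lt_min_iff]; exact ⟨⟨⟨h₁, h₂⟩, h₃, h₄⟩, ⟨⟨h₅, h₆⟩, h₇, h₈⟩, h₉, h₀⟩
  have hle : m ≤ t₁ ∧ m ≤ t₂ ∧ m ≤ t₃ ∧ m ≤ t₄ ∧ m ≤ t₅ ∧ m ≤ t₆ ∧ m ≤ t₇ ∧ m ≤ t₈ ∧ m ≤ t₉ ∧ m ≤ t₀ := by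
    simp only [hm, min_le_iff, le_refl, true_or, or_true, and_self]
  obtain ⟨l₁, l₂, l₃, l₄, l₅, l₆, l₇, l₈, l₉, l₀⟩ := hle
  exact ⟨m / 2, by linarith, by linarith, by linarith, by linarith, by linarith, by linarith,
    by linarith, by linarith, by linarith, by linarith, by linarith⟩

/-- Sign control near a real zero: with `r, C` from Lemma A and `0 < ε, y` small,
`Im (g'/g)(x + iy) < 0` for `|x − a| = ε`-type points. -/
private theorem im_neg_of_bound {ψim y d C M y₀ : ℝ} (hy : 0 < y) (hd : 0 < d)
    (hbound : ψim ≤ -y / d + C * y) (hCM : |C| ≤ M) (hM : 0 < M) (hdy : d ≤ 2 * y₀ ^ 2)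
    (hy₀M : y₀ * M ≤ 1 / 4) (hy₀ : 0 < y₀) (hy₀1 : y₀ ≤ 1) : ψim < 0 := by
  have h1 : C * d < 1 := by
    have h2 : C * d ≤ |C| * d := by nlinarith [le_abs_self C]
    have h3 : |C| * d ≤ M * (2 * y₀ ^ 2) := by nlinarith [abs_nonneg C]
    nlinarith
  have h4 : -y / d + C * y = y * (C * d - 1) / d := by field_simp; ring
  rw [h4] at hbound
  have h5 : y * (C * d - 1) / d < 0 := div_neg_of_neg_of_pos (by nlinarith) hd
  linarith

set_option maxHeartbeats 800000 in
open Summit.RiemannHypothesis.RiemannHypothesis.Theses in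
/-- **The route item `EarlyAppointments.LocalFourierPolya` (stmt-RiemannHypothesis-3185) holds.** -/
theorem localFourierPolya : EarlyAppointments.LocalFourierPolya := by
  intro g α β Y hg hreal hαβ hY hgα hgβ hw hA hsign
  obtain ⟨w, hw0, hwα, hwβ, hwim, hwY⟩ := hw
  have htop : ∀ x ∈ Icc α β,
      (deriv g ((x : ℂ) + (Y : ℂ) * I) / g ((x : ℂ) + (Y : ℂ) * I)).im < 0 :=
    fun x hx ↦ hsign _ (Or.inl ⟨by simp, by simpa using hx.1, by simpa using hx.2⟩)
  have hsideα : ∀ y ∈ Ioc (0 : ℝ) Y,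
      (deriv g ((α : ℂ) + (y : ℂ) * I) / g ((α : ℂ) + (y : ℂ) * I)).im < 0 :=
    fun y hy ↦ hsign _ (Or.inr ⟨Or.inl (by simp), by simpa using hy.1, by simpa using hy.2⟩)
  have hsideβ : ∀ y ∈ Ioc (0 : ℝ) Y,
      (deriv g ((β : ℂ) + (y : ℂ) * I) / g ((β : ℂ) + (y : ℂ) * I)).im < 0 :=
    fun y hy ↦ hsign _ (Or.inr ⟨Or.inr (by simp), by simpa using hy.1, by simpa using hy.2⟩)
  have hne : ∃ z, g z ≠ 0 := ⟨(α : ℂ) + (Y : ℂ) * I, fun h0 ↦ by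
    have h1 := htop α ⟨le_rfl, hαβ.le⟩
    rw [h0, div_zero, Complex.zero_im] at h1
    exact lt_irrefl _ h1⟩
  have hne' : ∃ z, deriv g z ≠ 0 := ⟨(α : ℂ) + (Y : ℂ) * I, fun h0 ↦ by
    have h1 := htop α ⟨le_rfl, hαβ.le⟩
    rw [h0, zero_div, Complex.zero_im] at h1
    exact lt_irrefl _ h1⟩
  have hg' := differentiable_deriv hg
  -- local expansions at the endpoints
  obtain ⟨rα, hrα, Cα, hAα⟩ := logDeriv_im_le_near_real_zero hg hreal hne hgα
  obtain ⟨rβ, hrβ, Cβ, hAβ⟩ := logDeriv_im_le_near_real_zero hg hreal hne hgβ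
  set M : ℝ := |Cα| + |Cβ| + 1 with hM
  have hM0 : 0 < M := by positivity
  have hM1 : 1 ≤ M := by have := abs_nonneg Cα; have := abs_nonneg Cβ; linarith
  -- the height y₀
  obtain ⟨y₀, hy₀, hy₀Y, hy₀α, hy₀β, hy₀M', -, -, -, -, -, -⟩ :=
    exists_pos_lt_ten hY (half_pos hrα) (half_pos hrβ) (show 0 < 1 / (4 * M) by positivity)
      hY hY hY hY hY hY
  have hy₀M : y₀ * M ≤ 1 / 4 := by
    have := (lt_div_iff₀ (by positivity : (0 : ℝ) < 4 * M)).mp hy₀M'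
    linarith
  have hy₀1 : y₀ ≤ 1 := by nlinarith
  -- compact parts
  obtain ⟨δα, hδα, hTα⟩ := sign_persists_near_segment hg (a := α) (y₀ := y₀) (Y := Y)
    (fun y hy ↦ hsideα y ⟨lt_of_lt_of_le hy₀ hy.1, hy.2⟩)
  obtain ⟨δβ, hδβ, hTβ⟩ := sign_persists_near_segment hg (a := β) (y₀ := y₀) (Y := Y)
    (fun y hy ↦ hsideβ y ⟨lt_of_lt_of_le hy₀ hy.1, hy.2⟩)
  -- isolated zeros of g and g'
  obtain ⟨s₁, hs₁, hz₁⟩ := exists_ball_ne_zero_of_entire hg hne (α : ℂ)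
  obtain ⟨s₂, hs₂, hz₂⟩ := exists_ball_ne_zero_of_entire hg hne (β : ℂ)
  obtain ⟨s₃, hs₃, hz₃⟩ := exists_ball_ne_zero_of_entire hg' hne' (α : ℂ)
  obtain ⟨s₄, hs₄, hz₄⟩ := exists_ball_ne_zero_of_entire hg' hne' (β : ℂ)
  -- the shift ε
  obtain ⟨ε, hε, hεy, hεδα, hεδβ, hε₁, hε₂, hε₃, hε₄, hεwα, hεwβ, hεαβ⟩ :=
    exists_pos_lt_ten hy₀ hδα hδβ hs₁ hs₂ hs₃ hs₄ (show 0 < w.re - α by linarith)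
      (show 0 < β - w.re by linarith) (show 0 < (β - α) / 2 by linarith)
  -- distances of the shifted endpoints
  have dα : dist (((α + ε : ℝ)) : ℂ) (α : ℂ) = ε := by
    rw [dist_eq_norm, ← Complex.ofReal_sub, Complex.norm_real, Real.norm_eq_abs]
    simp [abs_of_pos hε]
  have dβ : dist (((β - ε : ℝ)) : ℂ) (β : ℂ) = ε := by
    rw [dist_eq_norm, ← Complex.ofReal_sub, Complex.norm_real, Real.norm_eq_abs]
    simp [abs_of_pos hε]
  have neα : (((α + ε : ℝ)) : ℂ) ≠ (α : ℂ) := by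
    intro h; have := congrArg Complex.re h; simp at this; exact hε.ne' this
  have neβ : (((β - ε : ℝ)) : ℂ) ≠ (β : ℂ) := by
    intro h; have := congrArg Complex.re h; simp at this; exact hε.ne' this
  have hfα : g ((α + ε : ℝ) : ℂ) ≠ 0 := hz₁ _ neα (by rw [dα]; exact hε₁)
  have hfβ : g ((β - ε : ℝ) : ℂ) ≠ 0 := hz₂ _ neβ (by rw [dβ]; exact hε₂)
  have hdα : deriv g ((α + ε : ℝ) : ℂ) ≠ 0 := hz₃ _ neα (by rw [dα]; exact hε₃)
  have hdβ : deriv g ((β - ε : ℝ) : ℂ) ≠ 0 := hz₄ _ neβ (by rw [dβ]; exact hε₄)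
  -- sign on the shifted vertical sides
  have side : ∀ {a x r C δ : ℝ}, |x - a| = ε → ε < r / 2 →
      (∀ x y : ℝ, |x - a| < r → x ≠ a → 0 < y → y < r →
        (deriv g ((x : ℂ) + (y : ℂ) * I) / g ((x : ℂ) + (y : ℂ) * I)).im ≤
          -y / ((x - a) ^ 2 + y ^ 2) + C * y) →
      |C| ≤ M → y₀ < r / 2 → ε < δ →
      (∀ x y : ℝ, |x - a| < δ → y ∈ Icc y₀ Y →
        (deriv g ((x : ℂ) + (y : ℂ) * I) / g ((x : ℂ) + (y : ℂ) * I)).im < 0) →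
      ∀ y ∈ Ioc (0 : ℝ) Y, (deriv g ((x : ℂ) + (y : ℂ) * I) / g ((x : ℂ) + (y : ℂ) * I)).im < 0 := by
    intro a x r C δ hxa hεr hA hCM hy₀r hεδ hT y hy
    by_cases hyy : y ≤ y₀
    · have hxne : x ≠ a := by
        intro h; rw [h, sub_self, abs_zero] at hxa; exact hε.ne' hxa.symm
      have hb := hA x y (by rw [hxa]; linarith) hxne hy.1 (by linarith)
      have hd : 0 < (x - a) ^ 2 + y ^ 2 := by positivity
      have hxa2 : (x - a) ^ 2 = ε ^ 2 := by rw [← sq_abs, hxa]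
      refine im_neg_of_bound hy.1 hd hb hCM hM0 ?_ hy₀M hy₀ hy₀1
      have e1 : ε ^ 2 < y₀ ^ 2 := pow_lt_pow_left₀ hεy hε.le two_ne_zero
      have e2 : y ^ 2 ≤ y₀ ^ 2 := pow_le_pow_left₀ hy.1.le hyy 2
      rw [hxa2]; clear hA hT hb; linarith
    · push Not at hyy
      exact hT x y (by rw [hxa]; exact hεδ) ⟨hyy.le, hy.2⟩
  have hCαM : |Cα| ≤ M := by have := abs_nonneg Cβ; linarith
  have hCβM : |Cβ| ≤ M := by have := abs_nonneg Cα; linarith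
  have hleft := side (a := α) (x := α + ε) (by simp [abs_of_pos hε]) (by linarith) hAα hCαM
    (by linarith) hεδα hTα
  have hright := side (a := β) (x := β - ε) (by simp [abs_of_pos hε]) (by linarith) hAβ hCβM
    (by linarith) hεδβ hTβ
  -- top edge, local A, the non-real zero, for the shifted window
  have htop' : ∀ x ∈ Icc (α + ε) (β - ε),
      (deriv g ((x : ℂ) + (Y : ℂ) * I) / g ((x : ℂ) + (Y : ℂ) * I)).im < 0 :=
    fun x hx ↦ htop x ⟨by linarith [hx.1], by linarith [hx.2]⟩
  have hA' : LocalA g (α + ε) (β - ε) Y := by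
    intro ρ hρ h0
    have h1 : ρ.re ∈ Ioo (α + ε) (β - ε) := by simpa [mem_reProdIm] using hρ.1
    have h2 : ρ.im ∈ Ioo (-Y) Y := by simpa [mem_reProdIm] using hρ.2
    exact hA ρ h0 (by linarith [h1.1]) (by linarith [h1.2]) (abs_le.mpr ⟨h2.1.le, h2.2.le⟩)
  have hz' : ∃ ρ ∈ Ioo (α + ε) (β - ε) ×ℂ Ioo (-Y) Y, g ρ = 0 ∧ ρ.im ≠ 0 := by
    refine ⟨w, ⟨?_, ?_⟩, hw0, ?_⟩
    · simpa [mem_reProdIm] using (⟨by linarith, by linarith⟩ : α + ε < w.re ∧ w.re < β - ε)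
    · have := abs_lt.mp hwY
      simpa [mem_reProdIm] using this
    · intro h; rw [h, abs_zero] at hwim; exact lt_irrefl _ hwim
  have hlt : α + ε < β - ε := by linarith
  obtain ⟨x, hx, hdx, hgx, hsg⟩ := exists_nonLaguerre_critical_of_boundary_sign hg hreal hlt hY
    (by exact_mod_cast hfα) (by exact_mod_cast hfβ) (by exact_mod_cast hdα) (by exact_mod_cast hdβ)
    (by exact_mod_cast htop') (by exact_mod_cast hleft) (by exact_mod_cast hright) hA' hz'
  -- translation to the real trace
  have hdF : deriv (fun t : ℝ ↦ (g t).re) x = (deriv g x).re :=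
    (KiKim.hasDerivAt_re_ofReal (hg.differentiableAt)).deriv
  have hdF' : deriv (fun t : ℝ ↦ (g t).re) = fun t : ℝ ↦ (deriv g t).re :=
    funext fun t ↦ (KiKim.hasDerivAt_re_ofReal (hg.differentiableAt)).deriv
  have hddF : iteratedDeriv 2 (fun t : ℝ ↦ (g t).re) x = (deriv (deriv g) x).re := by
    rw [show (2 : ℕ) = 1 + 1 from rfl, iteratedDeriv_succ, iteratedDeriv_one, hdF']
    exact (KiKim.hasDerivAt_re_ofReal (hg'.differentiableAt)).deriv
  refine ⟨x, by linarith [hx.1], by linarith [hx.2], by rw [hdF, hdx]; simp,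
    fun h0 ↦ hgx (Complex.ext (by simpa using h0) (by simp [hreal x])), ?_⟩
  rw [hddF]
  have e : (g x * deriv (deriv g) x).re = (g x).re * (deriv (deriv g) x).re := by
    rw [Complex.mul_re, hreal x]; ring
  rw [← e]; exact hsg


end Summit.RiemannHypothesis.RiemannHypothesis.Theorems.Splittings.EarlyAppointmentsLocalFourierPolya
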